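import Literature.NumberTheory.GaloisRepresentations.WeakAbelianDirectSummandCyclotomicProofs
import Literature.NumberTheory.GaloisRepresentations.WeilGroupFrobeniusPowers
import Literature.NumberTheory.GaloisRepresentations.LocalGaloisGroupFrobeniusProofs
import Literature.NumberTheory.GaloisRepresentations.LocalClassFieldTheory
import Literature.NumberTheory.Automorphic.AdicCompletionLocalField
import HarnessLib

/-!
# Stub N15-B′ of line `Sketch` (crux `ReciprocityUpToIrreducibility`, item stmt-Langlands-14328):
# the idelic norm through a local Artin map, `‖artin_v w‖_v = q_v^{deg w}`

Support file (closes nothing; registered stub `stub_normCharacter_localComponent_artin` of line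
`Sketch`, wave N15-B′, continuation lead c10).  In the rank-one row of global Langlands at a place
`v ∤ ℓ` the automorphic side of the pointwise Artin matching for a norm twist `χ₀‖·‖^k` factors as
`χ₀,v(artin_v w) · ‖artin_v w‖_v^k`; this file computes the norm factor for ANY local Artin datum
`d : LocalArtinData K_v` (clauses `image_inertia` and Deligne's `artin_frob` only):

* `normCharacter_localComponent_artin_eq_one_of_mem_inertia` — inertia goes to `𝒪_vˣ`
  (`LocalArtinData.image_inertia`), on which the local component of `‖·‖` is trivial
  (`HeckeCharacter.isUnramifiedAt_normCharacter`; the unit group of the local-field valuation of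
  `K_v` consists of units of `𝒪_v`, the two valuations of `K_v` being equivalent);
* `normCharacter_localComponent_artin_of_deg_eq_neg_one` — an element of degree `-1` goes to a
  uniformiser (`LocalArtinData.artin_frob`), which differs from the tree's uniformiser `ϖ_v`
  (`Valued.v ϖ_v = exp (-1)`) by a unit (a uniformiser has the largest value `< 1`), so its
  `‖·‖_v`-value is `‖ϖ_v‖ = q_v⁻¹` (`HeckeCharacter.valueAtUniformizer_normCharacter`);
* `normCharacter_localComponent_artin` / `stub_normCharacter_localComponent_artin` — for every
  `w ∈ W_{K_v}`, `‖artin_v w‖_v = q_v^{deg w}`: `W_{K_v}` is generated by inertia and one element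
  `Φ` of degree `-1` (`WeilGroup.deg_surjective`, `WeilGroup.zpow_deg_mul_mem_inertia`:
  `Φ^{deg w} · w ∈ I`), and the local component is multiplicative.

Imports are Literature-only (no `Theses` module in the closure); the two bridges between the
adelic and the local-field normalisations of `K_v` are private `_aux` lemmas (variants of c4's
`exists_unitsMap_eq_of_mem_unitGroup` / `mul_inv_mem_unitGroup_of_isUniformizer` of
`…RankOneLocalComponent` / `…RankOneUnramified`, the latter re-proved from the generator of the
value group instead of `IsUniformizingElement`).  No definitions; std axioms; no named fact.
-/

noncomputable section

set_option linter.dupNamespace false -- project-wide option (lakefile weak.linter.dupNamespace); `Summit.Langlands.Langlands` is the mandated namespace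

open scoped NumberField Classical
open Filter IsDedekindDomain
open Literature.NumberTheory.Automorphic Literature.NumberTheory.GaloisRepresentations

namespace Summit.Langlands.Langlands.Theorems.ReciprocityUpToIrreducibility

section NormCharacterArtin

variable {K : Type} [Field K] [NumberField K]

/-- In a rank-one discrete valuation every value `< 1` is at most the generator of the value
group: the value group is `γ^ℤ` with `γ < 1` the generator, and `γ^k < 1` forces `k ≥ 1`.
[folklore] -/
private theorem val_le_generator_of_lt_one_aux {F Γ : Type*} [Field F]
    [LinearOrderedCommGroupWithZero Γ] (w : Valuation F Γ) [w.IsRankOneDiscrete] {x : F}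
    (hx : w x < 1) : w x ≤ (Valuation.IsRankOneDiscrete.generator w : Γ) := by
  by_cases hx0 : w x = 0
  · rw [hx0]; exact zero_le
  have hmem : w x ∈ Set.range w \ {0} := ⟨⟨x, rfl⟩, hx0⟩
  rw [← Valuation.IsRankOneDiscrete.generator_zpowers_eq_range F w] at hmem
  obtain ⟨g, hg, hgx⟩ := hmem
  obtain ⟨k, rfl⟩ := Subgroup.mem_zpowers_iff.mp hg
  rw [← hgx, Units.val_zpow_eq_zpow_val] at hx ⊢
  have h0 : (0 : Γ) < (Valuation.IsRankOneDiscrete.generator w : Γ) :=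
    zero_lt_iff.mpr (Valuation.IsRankOneDiscrete.generator_ne_zero w)
  have h1 : ((Valuation.IsRankOneDiscrete.generator w : Γˣ) : Γ) < 1 := by
    rw [← Units.val_one, Units.val_lt_val]
    exact Valuation.IsRankOneDiscrete.generator_lt_one w
  have hk : 0 < k := (zpow_lt_one_iff_right_of_lt_one₀ h0 h1).mp hx
  calc (Valuation.IsRankOneDiscrete.generator w : Γ) ^ k
      ≤ (Valuation.IsRankOneDiscrete.generator w : Γ) ^ (1 : ℤ) :=
        (zpow_le_zpow_iff_right_of_lt_one₀ h0 h1).mpr (by omega)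
    _ = _ := zpow_one _

/-- At an unramified place the local component `χ_v` kills the unit group of the local-field
valuation of `K_v`: such a unit is (the image of) a unit of `𝒪_v = v.adicCompletionIntegers K`,
the valuations `ValuativeRel.valuation K_v` and `Valued.v` being equivalent
(`ValuativeRel.isEquiv`).  Private variant, adapted from c4's `exists_unitsMap_eq_of_mem_unitGroup` /
`localComponent_eq_one_of_mem_unitGroup` (`…RankOneLocalComponent`). [cite: TateThesis1967, §2.3] -/
private theorem localComponent_eq_one_of_mem_unitGroup_aux {χ : HeckeCharacter K}
    {v : HeightOneSpectrum (𝓞 K)} (hχ : χ.IsUnramifiedAt v) {u : (v.adicCompletion K)ˣ}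
    (hu : u ∈ (ValuativeRel.valuation (v.adicCompletion K)).valuationSubring.unitGroup) :
    χ.localComponent v u = 1 := by
  rw [Valuation.mem_unitGroup_iff, ← (ValuativeRel.isEquiv
    (Valued.v : Valuation (v.adicCompletion K) _)
    (ValuativeRel.valuation (v.adicCompletion K))).eq_one_iff_eq_one] at hu
  have h1 : (u : v.adicCompletion K) ∈ v.adicCompletionIntegers K := by
    rw [HeightOneSpectrum.mem_adicCompletionIntegers, hu]
  have h2 : ((u⁻¹ : (v.adicCompletion K)ˣ) : v.adicCompletion K) ∈ v.adicCompletionIntegers K := by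
    rw [HeightOneSpectrum.mem_adicCompletionIntegers, Units.val_inv_eq_inv_val, map_inv₀, hu,
      inv_one]
  have h := hχ ⟨⟨_, h1⟩, ⟨_, h2⟩, Subtype.ext u.mul_inv, Subtype.ext u.inv_mul⟩
  rwa [show Units.map ((v.adicCompletionIntegers K).subtype : _ →* _)
      ⟨⟨_, h1⟩, ⟨_, h2⟩, Subtype.ext u.mul_inv, Subtype.ext u.inv_mul⟩ = u from Units.ext rfl] at h

/-- Two uniformisers of `K_v` — `ϖ` in the adelic normalisation `Valued.v ϖ = exp (-1)` and `ϖ'`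
for the local-field valuation `ValuativeRel.valuation K_v` (Mathlib's `Valuation.IsUniformizer`)
— differ by an element of the unit group: the two valuations are equivalent, `v(ϖ) < 1` gives
`v(ϖ) ≤ generator = v(ϖ')` (`val_le_generator_of_lt_one_aux`), and `Valued.v ϖ' < 1 = exp (-1) ·
exp 1` gives `Valued.v ϖ' ≤ Valued.v ϖ`.  Private variant of c4's
`mul_inv_mem_unitGroup_of_isUniformizer` (`…RankOneUnramified`). [folklore] -/
private theorem mul_inv_mem_unitGroup_of_isUniformizer_aux {v : HeightOneSpectrum (𝓞 K)}
    {ϖ ϖ' : (v.adicCompletion K)ˣ}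
    (hϖ : Valued.v (ϖ : v.adicCompletion K) = WithZero.exp (-1 : ℤ))
    (hϖ' : (ValuativeRel.valuation (v.adicCompletion K)).IsUniformizer
      (ϖ' : v.adicCompletion K)) :
    ϖ' * ϖ⁻¹ ∈ (ValuativeRel.valuation (v.adicCompletion K)).valuationSubring.unitGroup := by
  have he := ValuativeRel.isEquiv (Valued.v : Valuation (v.adicCompletion K) _)
    (ValuativeRel.valuation (v.adicCompletion K))
  have hlt : Valued.v (ϖ : v.adicCompletion K) < 1 := by
    rw [hϖ, ← WithZero.exp_zero, WithZero.exp_lt_exp]; norm_num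
  have h1 : ValuativeRel.valuation (v.adicCompletion K) (ϖ : v.adicCompletion K) ≤
      ValuativeRel.valuation (v.adicCompletion K) (ϖ' : v.adicCompletion K) := by
    rw [hϖ'.val]
    exact val_le_generator_of_lt_one_aux _ (he.lt_one_iff_lt_one.mp hlt)
  have h2 : ValuativeRel.valuation (v.adicCompletion K) (ϖ' : v.adicCompletion K) ≤
      ValuativeRel.valuation (v.adicCompletion K) (ϖ : v.adicCompletion K) := by
    rw [← he.le_iff_le, hϖ, ← WithZero.lt_mul_exp_iff_le WithZero.exp_ne_zero, ← WithZero.exp_add,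
      neg_add_cancel, WithZero.exp_zero]
    exact he.lt_one_iff_lt_one.mpr hϖ'.val_lt_one
  have h0 : ValuativeRel.valuation (v.adicCompletion K) (ϖ : v.adicCompletion K) ≠ 0 :=
    (Valuation.ne_zero_iff _).mpr ϖ.ne_zero
  rw [Valuation.mem_unitGroup_iff, Units.val_mul, Units.val_inv_eq_inv_val, map_mul, map_inv₀,
    le_antisymm h2 h1, mul_inv_cancel₀ h0]

/-- **Inertia has norm `1`.**  For every local Artin datum `d` of `K_v` and every `u` in the
inertia group of `W_{K_v}`, the local component at `v` of the norm character is trivial at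
`d.artin u`: `d.artin u ∈ 𝒪_vˣ` (`LocalArtinData.image_inertia`) and `‖·‖` is unramified at `v`
(`HeckeCharacter.isUnramifiedAt_normCharacter`).
[cite: TateCorvallis1979, (1.4.1), (1.4.6)] [cite: TateThesis1967, Lemma 2.3.1] -/
theorem normCharacter_localComponent_artin_eq_one_of_mem_inertia (v : HeightOneSpectrum (𝓞 K))
    (d : LocalArtinData (v.adicCompletion K)) {u : WeilGroup (v.adicCompletion K)}
    (hu : u ∈ WeilGroup.inertia (v.adicCompletion K)) :
    (HeckeCharacter.normCharacter K).localComponent v (d.artin u) = 1 := by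
  refine localComponent_eq_one_of_mem_unitGroup_aux
    (HeckeCharacter.isUnramifiedAt_normCharacter v) ?_
  rw [← d.image_inertia]
  exact Subgroup.mem_map_of_mem d.artin hu

/-- **A degree-`(-1)` element has norm `q_v⁻¹`.**  For every local Artin datum `d` of `K_v` and
every `Φ ∈ W_{K_v}` with `deg Φ = -1` (a geometric Frobenius), `‖d.artin Φ‖_v = q_v⁻¹`:
`d.artin Φ` is a uniformiser (`LocalArtinData.artin_frob`, Deligne's normalisation), it differs
from the tree's uniformiser `ϖ_v` by a unit (`mul_inv_mem_unitGroup_of_isUniformizer_aux`) killed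
by the unramified `‖·‖_v`, and `‖ϖ_v‖ = q_v⁻¹` (`HeckeCharacter.valueAtUniformizer_normCharacter`).
[cite: TateCorvallis1979, (1.4.1), (1.4.6)] [cite: TateThesis1967, §4.3] -/
theorem normCharacter_localComponent_artin_of_deg_eq_neg_one (v : HeightOneSpectrum (𝓞 K))
    (d : LocalArtinData (v.adicCompletion K)) {Φ : WeilGroup (v.adicCompletion K)}
    (hΦ : WeilGroup.deg Φ = -1) :
    (((HeckeCharacter.normCharacter K).localComponent v (d.artin Φ) : ℂˣ) : ℂ) =
      (((v.residueCard : ℕ) : ℂ))⁻¹ := by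
  have hu := mul_inv_mem_unitGroup_of_isUniformizer_aux (HeckeCharacter.valued_uniformizer v)
    (d.artin_frob Φ hΦ)
  have h1 : (HeckeCharacter.normCharacter K).localComponent v (d.artin Φ) =
      (HeckeCharacter.normCharacter K).localComponent v (HeckeCharacter.uniformizer K v) := by
    have : d.artin Φ =
        (d.artin Φ * (HeckeCharacter.uniformizer K v)⁻¹) * HeckeCharacter.uniformizer K v := by
      rw [inv_mul_cancel_right]
    rw [this, map_mul, localComponent_eq_one_of_mem_unitGroup_aux
      (HeckeCharacter.isUnramifiedAt_normCharacter v) hu, one_mul]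
  rw [h1, ← HeckeCharacter.valueAtUniformizer_normCharacter v]
  rfl

/-- **The idelic norm through a local Artin map: `‖d.artin w‖_v = q_v^{deg w}`.**  For every
finite place `v` of `K`, every local Artin datum `d` of `K_v` and every `w ∈ W_{K_v}`, the local
component at `v` of the norm character takes the value `q_v^{deg w}` at `d.artin w`.  Proof:
pick `Φ` with `deg Φ = -1` (`WeilGroup.deg_surjective`); then `Φ^{deg w} · w` lies in inertia
(`WeilGroup.zpow_deg_mul_mem_inertia`), so `‖d.artin Φ‖^{deg w} · ‖d.artin w‖ = 1`
(`normCharacter_localComponent_artin_eq_one_of_mem_inertia`), and `‖d.artin Φ‖ = q_v⁻¹`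
(`normCharacter_localComponent_artin_of_deg_eq_neg_one`).
[cite: TateCorvallis1979, (1.4.1), (1.4.6)] [cite: NeukirchANT1999, Ch. VII §6 (6.9)] -/
theorem normCharacter_localComponent_artin (v : HeightOneSpectrum (𝓞 K))
    (d : LocalArtinData (v.adicCompletion K)) (w : WeilGroup (v.adicCompletion K)) :
    (((HeckeCharacter.normCharacter K).localComponent v (d.artin w) : ℂˣ) : ℂ) =
      ((v.residueCard : ℕ) : ℂ) ^ (WeilGroup.deg w) := by
  obtain ⟨Φ, hΦ⟩ := WeilGroup.deg_surjective IsFrobPow.mul_holds IsFrobPow.unique_holds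
    (exists_isFrobPow_holds (v.adicCompletion K)) (-1 : ℤ)
  have hI : (HeckeCharacter.normCharacter K).localComponent v
      (d.artin (Φ ^ (WeilGroup.deg w) * w)) = 1 :=
    normCharacter_localComponent_artin_eq_one_of_mem_inertia v d
      (WeilGroup.zpow_deg_mul_mem_inertia hΦ w)
  rw [map_mul, map_mul, map_zpow, map_zpow] at hI
  rw [eq_inv_of_mul_eq_one_right hI, Units.val_inv_eq_inv_val, Units.val_zpow_eq_zpow_val,
    normCharacter_localComponent_artin_of_deg_eq_neg_one v d hΦ, inv_zpow, inv_inv]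

end NormCharacterArtin

/-- **Registered stub `stub_normCharacter_localComponent_artin` of line `Sketch` (crux
stmt-Langlands-14328, wave N15-B′): the idelic norm through a local Artin map.**  For every finite
place `v` of `K`, every local Artin datum `d` of `K_v` (ANY `LocalArtinData`: `image_inertia` +
Deligne's `artin_frob`) and every `w ∈ W_{K_v}`: `‖d.artin w‖_v = q_v^{deg w}`, i.e. the local
component at `v` of the norm character takes the value `q_v^{deg w}` at `d.artin w`
(`valueAtUniformizer_normCharacter`: `‖ϖ_v‖ = q_v⁻¹`; inertia ↦ `𝒪_vˣ`, norm `1`; `deg`-`(-1)`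
elements ↦ uniformisers; `W_{K_v}` is generated by inertia and one such element).  Closed form of
`normCharacter_localComponent_artin`.
[cite: TateCorvallis1979, (1.4.1), (1.4.6)] [cite: NeukirchANT1999, Ch. VII §6 (6.9)] -/
theorem stub_normCharacter_localComponent_artin :
    ∀ (K : Type) [Field K] [NumberField K] (v : HeightOneSpectrum (𝓞 K))
      (d : LocalArtinData (v.adicCompletion K)) (w : WeilGroup (v.adicCompletion K)),
      (((HeckeCharacter.normCharacter K).localComponent v (d.artin w) : ℂˣ) : ℂ) =
        ((v.residueCard : ℕ) : ℂ) ^ (WeilGroup.deg w) :=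
  fun _ _ _ v d w => normCharacter_localComponent_artin v d w

end Summit.Langlands.Langlands.Theorems.ReciprocityUpToIrreducibility

end
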